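import Mathlib
import Summits.KontsevichZagierPeriods.Zeta5Search.WedgeDictionaryConsequences
import Summits.KontsevichZagierPeriods.Zeta5Search.WedgeDictionaryQPart
import HarnessLib

/-!
# ζ(5) search — class `elim`: CONTIGUOUS PARTNERS GIVE ONE ELIMINANT (cell `pub-zeta5`, fam-elim, E-L10)

HONEST FRAMING: systematic search; no irrationality claim unless certified.
(Filed for `fam-elim` g8 by the lead/lit g12 lane: statements and proofs byte-identical to the staged E-L10 file
`HOME/lean/ElimContiguousPartners.lean` (sha256 39eb7f73…) except ONE announced rename — the eliminant
`stepElim b i` is called `partnerElim b i` here (and `stepElim_eq`/`stepElim_partner_independent` →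
`partnerElim_eq`/`partnerElim_partner_independent`), because the fully-qualified name `Elimination.stepElim` is
already the real-sequence step eliminant of `Elimination/StepEliminant.lean`.)

OUR work (Summit side; `families/elim/FAMILY.md` §17.2, lemma (S2) of the gen-7 γ-census, there checked EXACTLY
on 105 rational `3 × 3` determinants and proved on paper).  This file makes it a THEOREM, as a corollary of the
typer's coefficient-level contiguity lemma `WedgeDictionary.coeff_update_sub` (the canonical coefficients
`U = coeffU`, `W = coeffW`, `V = coeffV` of Brown–Zudilin's dual very-well-poised series `F̃₇ = vwpDual 7`
satisfy `X(b + e_i) − X(b + e_k) = (b_i − b_k)(b₀ − b_i − b_k)·X(b)` for `X ∈ {U, W, V}`) and of the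
decomposition theorem `WedgeDictionary.vwp_decomposition` (`F̃₇(b) = U(b)ζ(5) + W(b)ζ(3) − V(b)`).

The sub-class E0 of the elimination class (`FAMILY.md` §1) combines a dual form with a CONTIGUOUS partner:
for the base point `b` (in the box `InBox`, with `d(b) = dOf b = 3b₀ − Σ_j b_j ≥ 0`) and an
up-partner `b + e_i` (`b_i ≤ b₀`) the `ζ(3)`-ELIMINANT is

  `partnerElim b i := W(b + e_i)·F̃₇(b) − W(b)·F̃₇(b + e_i) = Q_i(b)·ζ(5) − P_i(b)`,

`Q_i = U W_i' − U_i' W`, `P_i = W_i' V − W V_i'` the `2 × 2` minors of the two coefficient vectors (and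
`P̂_i = U V_i' − U_i' V` the `ζ(3)`-side companion).  By the wedge dictionary these minors are, up to the scalar
`ρ`, Brown–Zudilin's `(Q, P̂, P)` (the `Q`-part is the tree theorem `wedgeDictionary_Q`; §0 of the family file:
"E0 = BZ").  Proved here, with 0 `sorry`, for every `b` with `InBox b`, `0 ≤ d(b)` and all `i, k < 7` with
`b_{i+1}, b_{k+1} ≤ b₀`:

* `typeI_update_sub` — the three coefficient vectors `v(b) = (U, W, V)(b)`, `v(b + e_i)`, `v(b + e_k)` satisfy
  `v(b + e_i) − v(b + e_k) = κ_{ik} • v(b)` (vector form of `coeff_update_sub`);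
* `det_typeI_contiguous_eq_zero` — hence `det[v(b), v(b + e_i), v(b + e_k)] = 0`: the eight vectors
  `v(b), v(b + e_1), …, v(b + e_7)` lie in ONE PLANE through `v(b)` (nothing smaller is claimed: two members per
  elimination are still needed);
* `minorQ_partner_independent`, `minorPhat_partner_independent`, `minorP_partner_independent` — ALL THREE minors
  of the pair `(b, b + e_i)` are independent of the partner `i` (the `Q`-case is the typer's
  `wedgeQ_partner_independent`, restated in this file's names);
* `Q_eq_rho_mul_minorQ` — `Q(a) = ρ(a)·Q_i(b(a))` (the tree theorem `wedgeDictionary_Q`, E0 = BZ at the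
  `ζ(5)`-coefficient, for every admissible up-partner);
* `partnerElim_eq` — the eliminant is `ζ(3)`-free with exactly these coefficients: `partnerElim b i = Q_i ζ(5) − P_i`;
* `partnerElim_partner_independent` — and it is ONE real number for all seven up-partners.

Reading for the class (T4, structural): Brown–Zudilin's pair `(b, b + e₁)` is CANONICAL — inside E0 there is
exactly one eliminant per base point among the up-partners, so "design the search for partners with shared
denominators" has nothing to choose there (gen-1's partner atlas found 'partner choice immaterial' EXACTLY for
`|e| ≤ 2`; for the seven unit up-shifts it is now a theorem; the down-shifts `b − e_j` and `b ± e₀` are genuinely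
different pairs and are NOT covered).  What this is NOT: anything about sizes, denominators or irrationality.
-/

noncomputable section

open Finset

namespace Summit.KontsevichZagierPeriods.Zeta5Search.Elimination

open Summit.KontsevichZagierPeriods.Zeta5Search.DualSeries (InBox)
open Summit.KontsevichZagierPeriods.Zeta5Search.WedgeDictionary
open Literature.NumberTheory.Irrationality.BrownZudilin2022 (vwpDual bOfA Converges QOf)
open Literature.NumberTheory.Transcendental (zetaValue)

/-! ### The objects of the contiguous sub-class E0 -/

/-- The up-partner `b + e_{i+1}` (slot `i+1`, `i < 7`), written as in `WedgeDictionary.coeff_update_sub`. -/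
def up (b : ℕ → ℤ) (i : ℕ) : ℕ → ℤ := Function.update b (i + 1) (b (i + 1) + 1)

/-- The contiguity multiplier `κ_{ik}(b) = (b_{i+1} − b_{k+1})(b₀ − b_{i+1} − b_{k+1})`. -/
def kappa (b : ℕ → ℤ) (i k : ℕ) : ℚ := ((b (i + 1) - b (k + 1)) * (b 0 - b (i + 1) - b (k + 1)) : ℚ)

/-- The type-I coefficient vector `v(b) = (U(b), W(b), V(b))` of `F̃₇(b) = Uζ(5) + Wζ(3) − V`. -/
def typeI (b : ℕ → ℤ) : Fin 3 → ℚ := ![coeffU b, coeffW b, coeffV b]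

/-- The `ζ(5)`-coefficient of the E0 eliminant: `Q_i(b) = U(b)W(b+e_i) − U(b+e_i)W(b)`. -/
def minorQ (b : ℕ → ℤ) (i : ℕ) : ℚ := coeffU b * coeffW (up b i) - coeffU (up b i) * coeffW b

/-- The `ζ(3)`-side companion minor `P̂_i(b) = U(b)V(b+e_i) − U(b+e_i)V(b)`. -/
def minorPhat (b : ℕ → ℤ) (i : ℕ) : ℚ := coeffU b * coeffV (up b i) - coeffU (up b i) * coeffV b

/-- The constant term of the E0 eliminant: `P_i(b) = W(b+e_i)V(b) − W(b)V(b+e_i)`. -/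
def minorP (b : ℕ → ℤ) (i : ℕ) : ℚ := coeffW (up b i) * coeffV b - coeffW b * coeffV (up b i)

/-- The `ζ(3)`-ELIMINANT of the contiguous pair `(b, b + e_{i+1})`:
`W(b+e_i)·F̃₇(b) − W(b)·F̃₇(b+e_i)` (a real number). -/
def partnerElim (b : ℕ → ℤ) (i : ℕ) : ℝ :=
  (coeffW (up b i) : ℝ) * vwpDual 7 b - (coeffW b : ℝ) * vwpDual 7 (up b i)

/-! ### Linear dependence of three contiguous coefficient vectors -/

/-- Vector form of the coefficient-level contiguity lemma: `v(b+e_i) − v(b+e_k) = κ_{ik} • v(b)`. -/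
theorem typeI_update_sub (b : ℕ → ℤ) (hb : InBox b) (hd : 0 ≤ dOf b) {i k : ℕ} (hi : i ∈ range 7)
    (hk : k ∈ range 7) (hli : b (i + 1) ≤ b 0) (hlk : b (k + 1) ≤ b 0) :
    typeI (up b i) - typeI (up b k) = kappa b i k • typeI b := by
  obtain ⟨hU, hW, hV⟩ := coeff_update_sub b hb hd hi hk hli hlk
  ext j
  fin_cases j <;> simp [typeI, up, kappa, hU, hW, hV]

/-- **(S2) up-contiguity**: `det[v(b), v(b+e_i), v(b+e_k)] = 0` — three contiguous type-I coefficient vectors are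
linearly dependent; `v(b), v(b+e_1), …, v(b+e_7)` lie in one plane. -/
theorem det_typeI_contiguous_eq_zero (b : ℕ → ℤ) (hb : InBox b) (hd : 0 ≤ dOf b) {i k : ℕ}
    (hi : i ∈ range 7) (hk : k ∈ range 7) (hli : b (i + 1) ≤ b 0) (hlk : b (k + 1) ≤ b 0) :
    (Matrix.of ![typeI b, typeI (up b i), typeI (up b k)]).det = 0 := by
  obtain ⟨hU, hW, hV⟩ := coeff_update_sub b hb hd hi hk hli hlk
  have hU' : coeffU (up b i) = kappa b i k * coeffU b + coeffU (up b k) := by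
    have := hU; simp only [up, kappa] at this ⊢; linear_combination this
  have hW' : coeffW (up b i) = kappa b i k * coeffW b + coeffW (up b k) := by
    have := hW; simp only [up, kappa] at this ⊢; linear_combination this
  have hV' : coeffV (up b i) = kappa b i k * coeffV b + coeffV (up b k) := by
    have := hV; simp only [up, kappa] at this ⊢; linear_combination this
  rw [Matrix.det_fin_three]
  simp only [Matrix.of_apply, Matrix.cons_val_zero, Matrix.cons_val_one, Matrix.cons_val_two,
    Matrix.head_cons, Matrix.tail_cons, typeI]
  rw [hU', hW', hV']
  ring

/-! ### All three minors, and the eliminant itself, are partner-independent -/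

/-- `Q_i(b) = Q_k(b)` (the typer's `wedgeQ_partner_independent`, in this file's names). -/
theorem minorQ_partner_independent (b : ℕ → ℤ) (hb : InBox b) (hd : 0 ≤ dOf b) {i k : ℕ}
    (hi : i ∈ range 7) (hk : k ∈ range 7) (hli : b (i + 1) ≤ b 0) (hlk : b (k + 1) ≤ b 0) :
    minorQ b i = minorQ b k := by
  obtain ⟨hU, hW, -⟩ := coeff_update_sub b hb hd hi hk hli hlk
  unfold minorQ up
  linear_combination coeffU b * hW - coeffW b * hU

/-- `P̂_i(b) = P̂_k(b)`. -/
theorem minorPhat_partner_independent (b : ℕ → ℤ) (hb : InBox b) (hd : 0 ≤ dOf b) {i k : ℕ}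
    (hi : i ∈ range 7) (hk : k ∈ range 7) (hli : b (i + 1) ≤ b 0) (hlk : b (k + 1) ≤ b 0) :
    minorPhat b i = minorPhat b k := by
  obtain ⟨hU, -, hV⟩ := coeff_update_sub b hb hd hi hk hli hlk
  unfold minorPhat up
  linear_combination coeffU b * hV - coeffV b * hU

/-- `P_i(b) = P_k(b)`. -/
theorem minorP_partner_independent (b : ℕ → ℤ) (hb : InBox b) (hd : 0 ≤ dOf b) {i k : ℕ}
    (hi : i ∈ range 7) (hk : k ∈ range 7) (hli : b (i + 1) ≤ b 0) (hlk : b (k + 1) ≤ b 0) :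
    minorP b i = minorP b k := by
  obtain ⟨-, hW, hV⟩ := coeff_update_sub b hb hd hi hk hli hlk
  unfold minorP up
  linear_combination coeffV b * hW - coeffW b * hV

/-- **E0 = BZ at the `ζ(5)`-coefficient** (the tree theorem `wedgeDictionary_Q` in this file's names): for
`a` in the region of the wedge dictionary and an admissible partner slot `i+1`,
`Q(a) = ρ(a) · Q_i(b(a))` — the `ζ(5)`-coefficient of the E0 eliminant IS Brown–Zudilin's `Q(a)` up to the
closed scalar `ρ(a)`; with `minorQ_partner_independent`, for every admissible up-partner at once. -/
theorem Q_eq_rho_mul_minorQ (a : Fin 8 → ℤ) {i : ℕ} (hi : i ∈ range 7) (hconv : Converges a)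
    (hreg : ∀ l ∈ Icc 1 7, 0 ≤ bOfA a l ∧ 2 * bOfA a l ≤ bOfA a 0 + 1) (hd : 0 ≤ dOf (bOfA a))
    (hpart : 2 * (bOfA a (i + 1) + 1) ≤ bOfA a 0 + 1) :
    (QOf a : ℚ) = rhoOf a * minorQ (bOfA a) i :=
  wedgeDictionary_Q a (i + 1) (by have := mem_range.1 hi; exact mem_Icc.2 ⟨by omega, by omega⟩)
    hconv hreg hd hpart

/-- The up-partner stays in the box with the sum bound (restating `WedgeDictionary.box_update`). -/
theorem box_up (b : ℕ → ℤ) (hb : InBox b) (hd : 0 ≤ dOf b) {i : ℕ} (hi : i ∈ range 7)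
    (hli : b (i + 1) ≤ b 0) :
    InBox (up b i) ∧ ∑ l ∈ range 7, (up b i) (l + 1) ≤ 3 * (up b i) 0 + 1 :=
  box_update b hb hd hi hli

/-- **The E0 eliminant is `ζ(3)`-free with the dictionary's minors as coefficients:**
`W(b+e_i)·F̃₇(b) − W(b)·F̃₇(b+e_i) = Q_i(b)·ζ(5) − P_i(b)`. -/
theorem partnerElim_eq (b : ℕ → ℤ) (hb : InBox b) (hd : 0 ≤ dOf b) {i : ℕ} (hi : i ∈ range 7)
    (hli : b (i + 1) ≤ b 0) :
    partnerElim b i = (minorQ b i : ℝ) * zetaValue 5 - (minorP b i : ℝ) := by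
  have h0 := (vwp_decomposition b hb (sum_le_of_dOf b hd)).2
  obtain ⟨hbi, hsi⟩ := box_up b hb hd hi hli
  have h1 := (vwp_decomposition (up b i) hbi hsi).2
  unfold partnerElim
  rw [h0, h1]
  unfold minorQ minorP
  push_cast
  ring

/-- **One eliminant per base point**: `partnerElim b i = partnerElim b k` for all admissible up-partners `i, k`. -/
theorem partnerElim_partner_independent (b : ℕ → ℤ) (hb : InBox b) (hd : 0 ≤ dOf b) {i k : ℕ}
    (hi : i ∈ range 7) (hk : k ∈ range 7) (hli : b (i + 1) ≤ b 0) (hlk : b (k + 1) ≤ b 0) :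
    partnerElim b i = partnerElim b k := by
  rw [partnerElim_eq b hb hd hi hli, partnerElim_eq b hb hd hk hlk,
    minorQ_partner_independent b hb hd hi hk hli hlk, minorP_partner_independent b hb hd hi hk hli hlk]

end Summit.KontsevichZagierPeriods.Zeta5Search.Elimination

end
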